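import Mathlib.Analysis.Calculus.InverseFunctionTheorem.ContDiff
import Literature.Geometry.Lorentzian.MinimalSurfaceBarrier
import HarnessLib

/-!
# Hypersurfaces touching a coordinate slice from one side: tangency and local graphs
(family `gr`, in support of **gr.S09** `riemannian_penrose_inequality_connected_smooth` of
`MassInequalities.lean`; namespace `Literature.Geometry.Lorentzian`)

`MinimalSurfaceBarrier.lean` reduces the connected-horizon Riemannian Penrose inequality
(Huisken–Ilmanen, J. Differential Geom. 59 (2001)) to three named facts, the smallest of which is
the *barrier (tangency) principle* for minimal surfaces in slice-chart form,
`minimalSurface_barrierPrinciple`: an embedded minimal surface `Σ₂` lying, inside a box `O` of a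
chart `ψ` straightened by `T : ℝ³ ≃ ℝ² × ℝ`, in the closed lower half `{x³ ≤ 0}` of the coordinate
slice `Σ₁ ∩ O = {x³ = 0}` and touching it, coincides with it along the touching piece. The
classical proof of every tangency principle of this kind (Eschenburg, Manuscripta Math. 64
(1989), Thm. 1; Fontenele–Silva, Illinois J. Math. 45 (2001), Thm. 1.1) has three steps:
(1) near a touching point both hypersurfaces are graphs `t = u₁(x)`, `t = u₂(x)` over a common
coordinate hyperplane, with `u₂ ≤ u₁` and first-order contact at the touching point;
(2) the mean curvature of such a graph is a (quasilinear) elliptic expression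
`Φ(D²u, Du, u, x)` in the graph function (Fontenele–Silva, Lemma 3.1 and Props. 3.2, 3.4);
(3) Alexandrov's maximum principle for `C¹` elliptic `Φ` (linearise and apply E. Hopf's strong
maximum principle; Fontenele–Silva, §2) forces `u₁ = u₂` near the touching point.

This file **proves step (1)** in the generality of a `C^∞` immersion `f : S → X` of an
`n`-manifold into an `(n+1)`-manifold (models `𝓡 n`, `𝓡 (n+1)`, as for `exists_sliceBox`):

* `exists_graph_of_touching_below` — if an open piece `f '' W` lies in the closed lower half
  `{x ∈ O | (T (ψ x)).2 ≤ 0}` of a straightened chart `T ∘ ψ` (`O ⊆ ψ.source`) and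
  `(T (ψ (f y₀))).2 = 0` at some `y₀ ∈ W`, then for every neighbourhood `G` of the horizontal
  coordinate `x₀ = (T (ψ (f y₀))).1` there are an open `W₀` with `y₀ ∈ W₀ ⊆ W`, an open `V` with
  `x₀ ∈ V ⊆ G` and `u : ℝⁿ → ℝ`, `C^∞` on `V`, such that the horizontal coordinate maps `W₀`
  *onto* `V` and `f '' W₀` is exactly the graph of `u` over `V` in the chart
  (`(T (ψ (f y))).2 = u (T (ψ (f y))).1` on `W₀`), with `u ≤ 0` on `V`, `u x₀ = 0` and
  `du x₀ = 0` — the hypersurface is tangent to the slice at the touching point and lies below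
  it as a graph. In the slice charts of the immersion at `y₀` (Mathlib's `IsImmersionAt`: `f`
  reads `a ↦ equiv (a, 0)`), `F = T ∘ ψ ∘ f ∘ φ⁻¹ = T ∘ (ψ ∘ χ⁻¹) ∘ equiv ∘ (·, 0)` is smooth near
  `φ y₀` with injective differential (coordinate changes of the maximal atlas have invertible
  differential); its height component has a local maximum at `φ y₀`, so its differential
  vanishes there (Fermat), hence the horizontal component has bijective differential and is a
  local diffeomorphism (inverse function theorem), and `u = height ∘ horizontal⁻¹`.

Supporting lemmas (`TouchingGraph.contDiffOn_coordChange`,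
`TouchingGraph.isInvertible_fderiv_coordChange`) unwrap Mathlib's `extendCoordChange` API for the
boundaryless models `𝓡 k`. Steps (2)–(3) are not treated here.

## Mathlib

Used: `Manifold.IsImmersionAt` (`domChart`, `codChart`, `equiv`, `codChart_mem_maximalAtlas`,
`source_subset_preimage_source`) with `SliceBox.codChart_apply` of `MinimalSurfaceBarrier.lean`;
`ModelWithCorners.contDiffOn_extendCoordChange`, `isInvertible_fderivWithin_extendCoordChange`;
`IsLocalMax.hasFDerivAt_eq_zero`; the `C^r` inverse function theorem
`ContDiffAt.toOpenPartialHomeomorph` with `OpenPartialHomeomorph.contDiffAt_symm`,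
`hasFDerivAt_symm`; `LinearEquiv.ofInjectiveEndo` (injective endomorphisms of `ℝⁿ` are
invertible); `ContinuousLinearEquiv.isOpen` (invertibility is an open condition);
`OpenPartialHomeomorph.isOpen_image_of_subset_source`. Mathlib has no statement about
hypersurfaces touching from one side.

## References

* F. Fontenele, S. L. Silva, *A tangency principle and applications*, Illinois J. Math. 45
  (2001) 213–228: §1, (1.1) and the Definition following (1.4) (hypersurfaces as graphs
  `ϕ(x) = exp_p(x + μ(x)η₀)` over the common tangent space, "`M₁` remains above `M₂`" iff
  `μ₁ ≥ μ₂`), §2 (Maximum Principle for elliptic `Φ`), §3 (Lemma 3.1, Props. 3.2 and 3.4) and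
  §4 (proof of Thm. 1.1).
* J.-H. Eschenburg, *Maximum principle for hypersurfaces*, Manuscripta Math. 64 (1989) 55–75,
  Thm. 1.
* J. M. Lee, *Introduction to Smooth Manifolds*, 2nd ed., Springer 2013, Thm. 4.5 (inverse
  function theorem for manifolds) and Thm. 5.8 (local slice criterion).
-/

noncomputable section

open Bundle Set Manifold TopologicalSpace Filter Function
open scoped ContDiff Topology Manifold

namespace Literature.Geometry.Lorentzian

namespace TouchingGraph

/-! #### Coordinate changes of the maximal atlas (boundaryless Euclidean models) -/

section CoordChange

variable {k : ℕ} {X : Type*} [TopologicalSpace X] [ChartedSpace (EuclideanSpace ℝ (Fin k)) X]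
  {χ ψ : OpenPartialHomeomorph X (EuclideanSpace ℝ (Fin k))}

omit [ChartedSpace (EuclideanSpace ℝ (Fin k)) X] in
/-- Unfolding lemma: for the boundaryless model `𝓡 k` the source of Mathlib's extended coordinate
change `extendCoordChange χ ψ` is `χ.target ∩ χ⁻¹ ⁻¹' ψ.source`. [folklore] -/
lemma extendCoordChange_source_eq (χ ψ : OpenPartialHomeomorph X (EuclideanSpace ℝ (Fin k))) :
    ((𝓡 k).extendCoordChange χ ψ).source = χ.target ∩ χ.symm ⁻¹' ψ.source := by
  rw [ModelWithCorners.extendCoordChange_source]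
  simp

omit [ChartedSpace (EuclideanSpace ℝ (Fin k)) X] in
/-- Unfolding lemma: for the boundaryless model `𝓡 k` Mathlib's extended coordinate change
`extendCoordChange χ ψ` is the map `ψ ∘ χ⁻¹`. [folklore] -/
lemma extendCoordChange_coe (χ ψ : OpenPartialHomeomorph X (EuclideanSpace ℝ (Fin k))) :
    (((𝓡 k).extendCoordChange χ ψ) : EuclideanSpace ℝ (Fin k) → EuclideanSpace ℝ (Fin k)) =
      ψ ∘ χ.symm := by
  ext x
  simp [ModelWithCorners.extendCoordChange]

omit [ChartedSpace (EuclideanSpace ℝ (Fin k)) X] in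
/-- The source `χ.target ∩ χ⁻¹ ⁻¹' ψ.source` of the coordinate change `ψ ∘ χ⁻¹` is open.
[folklore] -/
lemma isOpen_coordChange_source (χ ψ : OpenPartialHomeomorph X (EuclideanSpace ℝ (Fin k))) :
    IsOpen (χ.target ∩ χ.symm ⁻¹' ψ.source) :=
  χ.isOpen_inter_preimage_symm ψ.open_source

/-- Coordinate changes between charts of the maximal `C^∞` atlas are smooth on their source.
[folklore] -/
lemma contDiffOn_coordChange (hχ : χ ∈ IsManifold.maximalAtlas (𝓡 k) ∞ X)
    (hψ : ψ ∈ IsManifold.maximalAtlas (𝓡 k) ∞ X) :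
    ContDiffOn ℝ ∞ (ψ ∘ χ.symm) (χ.target ∩ χ.symm ⁻¹' ψ.source) := by
  have h := (𝓡 k).contDiffOn_extendCoordChange hχ hψ
  rwa [extendCoordChange_source_eq, extendCoordChange_coe] at h

/-- The derivative of a coordinate change of the maximal `C^∞` atlas is invertible at every point
of its source. [folklore] -/
lemma isInvertible_fderiv_coordChange (hχ : χ ∈ IsManifold.maximalAtlas (𝓡 k) ∞ X)
    (hψ : ψ ∈ IsManifold.maximalAtlas (𝓡 k) ∞ X) {x : EuclideanSpace ℝ (Fin k)}
    (hx : x ∈ χ.target ∩ χ.symm ⁻¹' ψ.source) :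
    (fderiv ℝ (ψ ∘ χ.symm) x).IsInvertible := by
  have h := (𝓡 k).isInvertible_fderivWithin_extendCoordChange (by simp) hχ hψ (x := x)
    (by rw [extendCoordChange_source_eq]; exact hx)
  rw [extendCoordChange_source_eq, extendCoordChange_coe] at h
  rwa [fderivWithin_of_isOpen (isOpen_coordChange_source χ ψ) hx] at h

end CoordChange

end TouchingGraph

open TouchingGraph in
/-- **A hypersurface touching a coordinate slice from below is tangent to it and is locally a
graph below it.** Let `f : S → X` be a map of an `n`-manifold into an `(n+1)`-manifold (models
`𝓡 n`, `𝓡 (n+1)`) which is a `C^∞` immersion at `y₀`, `ψ` a chart of the maximal `C^∞` atlas of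
`X`, `T : ℝⁿ⁺¹ ≃L ℝⁿ × ℝ` a linear straightening and `O ⊆ ψ.source`; write `(T (ψ x)).1` for the
horizontal and `(T (ψ x)).2` for the height coordinate of `x`. Suppose that an open piece `f '' W`
(`W ∋ y₀` open) lies in the closed lower half `{x ∈ O | height ≤ 0}` and that `f y₀` has height
`0`. Then for every neighbourhood `G` of `x₀ = horizontal (f y₀)` there are an open `W₀` with
`y₀ ∈ W₀ ⊆ W`, an open `V` with `x₀ ∈ V ⊆ G` and `u : ℝⁿ → ℝ`, `C^∞` on `V`, such that the
horizontal coordinate maps `W₀` onto `V`, `height (f y) = u (horizontal (f y))` for `y ∈ W₀`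
(so `f '' W₀` is the graph of `u` over `V` in the chart `T ∘ ψ`), `u ≤ 0` on `V`, `u x₀ = 0` and
`du x₀ = 0` (first-order contact: the hypersurface is tangent to the slice at `f y₀`). This is
step (1) of the classical proof of the tangency principle — Fontenele–Silva, Illinois J. Math.
45 (2001), §1, (1.1) with the Definition after (1.4) ("`M₁` remains above `M₂`": the graph
functions satisfy `μ₁ ≥ μ₂`; there over the common tangent space via `exp_p`, here over the
slice of an arbitrary chart) and the first lines of the proof of Thm. 1.1; Eschenburg,
Manuscripta Math. 64 (1989), Thm. 1. Proof: in the slice charts `φ`, `χ` of the immersion at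
`y₀` (`χ (f z) = equiv (φ z, 0)`), `F := T ∘ (ψ ∘ χ⁻¹) ∘ equiv ∘ (·, 0)` agrees with
`T ∘ ψ ∘ f ∘ φ⁻¹` near `φ y₀`, is smooth with injective differential (the coordinate change
`ψ ∘ χ⁻¹` of the maximal atlas has invertible differential), its height component `g` has a
local maximum `0` at `φ y₀`, so `dg = 0` there (Fermat) and the horizontal component `P` has
injective, hence bijective, differential; by the inverse function theorem `P` is a local
diffeomorphism `Φ`, and `u := g ∘ Φ⁻¹` on `V := Φ '' A` for a small open `A ∋ φ y₀` on which
`dP` stays invertible and `P` maps into `G`.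
[cite: FonteneleSilva2001, §1 (1.1), Definition after (1.4), and proof of Thm. 1.1 (first step)]
[cite: Eschenburg1989, Thm. 1] -/
theorem exists_graph_of_touching_below {n : ℕ} {S : Type*} [TopologicalSpace S]
    [ChartedSpace (EuclideanSpace ℝ (Fin n)) S]
    {X : Type*} [TopologicalSpace X] [ChartedSpace (EuclideanSpace ℝ (Fin (n + 1))) X]
    {f : S → X} {y₀ : S} (hi : IsImmersionAt (𝓡 n) (𝓡 (n + 1)) ∞ f y₀)
    {ψ : OpenPartialHomeomorph X (EuclideanSpace ℝ (Fin (n + 1)))}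
    (hψ : ψ ∈ IsManifold.maximalAtlas (𝓡 (n + 1)) ∞ X)
    (T : EuclideanSpace ℝ (Fin (n + 1)) ≃L[ℝ] EuclideanSpace ℝ (Fin n) × ℝ) {O : Set X}
    (hOψ : O ⊆ ψ.source) {W : Set S} (hW : IsOpen W)
    (hWO : f '' W ⊆ {x | x ∈ O ∧ (T (ψ x)).2 ≤ 0}) (hy₀ : y₀ ∈ W) (h0 : (T (ψ (f y₀))).2 = 0)
    {G : Set (EuclideanSpace ℝ (Fin n))} (hG : G ∈ 𝓝 (T (ψ (f y₀))).1) :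
    ∃ (W₀ : Set S) (V : Set (EuclideanSpace ℝ (Fin n))) (u : EuclideanSpace ℝ (Fin n) → ℝ),
      IsOpen W₀ ∧ y₀ ∈ W₀ ∧ W₀ ⊆ W ∧ IsOpen V ∧ (T (ψ (f y₀))).1 ∈ V ∧ V ⊆ G ∧
      (fun y ↦ (T (ψ (f y))).1) '' W₀ = V ∧
      (∀ y ∈ W₀, (T (ψ (f y))).2 = u (T (ψ (f y))).1) ∧
      ContDiffOn ℝ ∞ u V ∧ (∀ x ∈ V, u x ≤ 0) ∧ u (T (ψ (f y₀))).1 = 0 ∧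
      fderiv ℝ u (T (ψ (f y₀))).1 = 0 := by
  -- notation
  set φ := hi.domChart with hφ
  set χ := hi.codChart with hχ
  have hχatlas : χ ∈ IsManifold.maximalAtlas (𝓡 (n + 1)) ∞ X := hi.codChart_mem_maximalAtlas
  set L : EuclideanSpace ℝ (Fin n) →L[ℝ] EuclideanSpace ℝ (Fin (n + 1)) :=
    (hi.equiv : (EuclideanSpace ℝ (Fin n) × hi.complement) →L[ℝ] EuclideanSpace ℝ (Fin (n + 1))).comp
      (ContinuousLinearMap.inl ℝ (EuclideanSpace ℝ (Fin n)) hi.complement) with hL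
  have hLapply : ∀ a, L a = hi.equiv (a, 0) := fun a ↦ by simp [hL]
  set τ : EuclideanSpace ℝ (Fin (n + 1)) → EuclideanSpace ℝ (Fin (n + 1)) := ψ ∘ χ.symm with hτ
  set D : Set (EuclideanSpace ℝ (Fin (n + 1))) := χ.target ∩ χ.symm ⁻¹' ψ.source with hD
  have hDopen : IsOpen D := isOpen_coordChange_source χ ψ
  have hτD : ContDiffOn ℝ ∞ τ D := contDiffOn_coordChange hχatlas hψ
  set F : EuclideanSpace ℝ (Fin n) → EuclideanSpace ℝ (Fin n) × ℝ := fun a ↦ T (τ (L a)) with hF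
  set P : EuclideanSpace ℝ (Fin n) → EuclideanSpace ℝ (Fin n) := fun a ↦ (F a).1 with hP
  set g : EuclideanSpace ℝ (Fin n) → ℝ := fun a ↦ (F a).2 with hg
  -- `F` is `T ∘ ψ ∘ f` read in the domain chart
  have hFchart : ∀ y ∈ φ.source, f y ∈ ψ.source → F (φ y) = T (ψ (f y)) := by
    intro y hy hyψ
    have hfy : f y ∈ χ.source := hi.source_subset_preimage_source hy
    have h1 : hi.equiv (φ y, 0) = χ (f y) := (SliceBox.codChart_apply hi hy).symm
    simp only [hF, hτ, comp_apply, hLapply, h1, χ.left_inv hfy]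
  -- the basic open set `A₁ = φ.target ∩ φ⁻¹ ⁻¹' W` and its properties
  set A₁ : Set (EuclideanSpace ℝ (Fin n)) := φ.target ∩ φ.symm ⁻¹' W with hA₁
  have hA₁open : IsOpen A₁ := φ.isOpen_inter_preimage_symm hW
  have hy₀φ : y₀ ∈ φ.source := hi.mem_domChart_source
  set a₀ := φ y₀ with ha₀
  have ha₀A₁ : a₀ ∈ A₁ := ⟨φ.map_source hy₀φ, by rw [mem_preimage, ha₀, φ.left_inv hy₀φ]; exact hy₀⟩
  have hWψ : ∀ y ∈ W, f y ∈ ψ.source := fun y hy ↦ hOψ (hWO (mem_image_of_mem f hy)).1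
  have hWle : ∀ y ∈ W, (T (ψ (f y))).2 ≤ 0 := fun y hy ↦ (hWO (mem_image_of_mem f hy)).2
  have hA₁F : ∀ a ∈ A₁, F a = T (ψ (f (φ.symm a))) := by
    rintro a ⟨ha, haW⟩
    rw [← hFchart (φ.symm a) (φ.map_target ha) (hWψ _ haW), φ.right_inv ha]
  have hA₁D : ∀ a ∈ A₁, L a ∈ D := by
    rintro a ⟨ha, haW⟩
    have hz : φ.symm a ∈ φ.source := φ.map_target ha
    have hfz : f (φ.symm a) ∈ χ.source := hi.source_subset_preimage_source hz
    have hLa : L a = χ (f (φ.symm a)) := by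
      rw [hLapply, SliceBox.codChart_apply hi hz, φ.right_inv ha]
    refine ⟨hLa ▸ χ.map_source hfz, ?_⟩
    rw [mem_preimage, hLa, χ.left_inv hfz]
    exact hWψ _ haW
  have hA₁g : ∀ a ∈ A₁, g a ≤ 0 := by
    intro a ha
    simp only [hg, hA₁F a ha]
    exact hWle _ ha.2
  have hga₀ : g a₀ = 0 := by
    simp only [hg]
    rw [hA₁F a₀ ha₀A₁, ha₀, φ.left_inv hy₀φ]
    exact h0
  -- smoothness of `F`, `P`, `g` on `A₁`
  have hFsmooth : ∀ a ∈ A₁, ContDiffAt ℝ ∞ F a := by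
    intro a ha
    have hτa : ContDiffAt ℝ ∞ τ (L a) := hτD.contDiffAt (hDopen.mem_nhds (hA₁D a ha))
    exact T.contDiff.contDiffAt.comp a (hτa.comp a L.contDiff.contDiffAt)
  have hPsmooth : ∀ a ∈ A₁, ContDiffAt ℝ ∞ P a := fun a ha ↦ (hFsmooth a ha).fst
  have hgsmooth : ∀ a ∈ A₁, ContDiffAt ℝ ∞ g a := fun a ha ↦ (hFsmooth a ha).snd
  -- the differential of `F` at `a₀` is injective
  set Dτ := fderiv ℝ τ (L a₀) with hDτ
  have hDτinv : Dτ.IsInvertible := isInvertible_fderiv_coordChange hχatlas hψ (hA₁D a₀ ha₀A₁)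
  set F' : EuclideanSpace ℝ (Fin n) →L[ℝ] EuclideanSpace ℝ (Fin n) × ℝ :=
    (T : EuclideanSpace ℝ (Fin (n + 1)) →L[ℝ] EuclideanSpace ℝ (Fin n) × ℝ).comp (Dτ.comp L)
    with hF'
  have hFderiv : HasFDerivAt F F' a₀ := by
    have hτa : HasFDerivAt τ Dτ (L a₀) :=
      ((hτD.contDiffAt (hDopen.mem_nhds (hA₁D a₀ ha₀A₁))).differentiableAt (by simp)).hasFDerivAt
    exact T.hasFDerivAt.comp a₀ (hτa.comp a₀ L.hasFDerivAt)
  have hF'inj : Injective F' := by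
    obtain ⟨E', hE'⟩ := hDτinv
    have hLinj : Injective L := by
      intro a b hab
      rw [hLapply, hLapply] at hab
      exact (Prod.ext_iff.mp (hi.equiv.injective hab)).1
    simp only [hF', ← hE']
    exact T.injective.comp (E'.injective.comp hLinj)
  -- Fermat: the height `g` has a local maximum at `a₀`, so its differential vanishes
  have hgmax : IsLocalMax g a₀ := by
    filter_upwards [hA₁open.mem_nhds ha₀A₁] with a ha
    rw [hga₀]
    exact hA₁g a ha
  have hgderiv : HasFDerivAt g ((ContinuousLinearMap.snd ℝ _ ℝ).comp F') a₀ := hFderiv.snd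
  have hg'zero : (ContinuousLinearMap.snd ℝ _ ℝ).comp F' = 0 := hgmax.hasFDerivAt_eq_zero hgderiv
  -- hence the horizontal part `P` has bijective differential at `a₀`
  set P' : EuclideanSpace ℝ (Fin n) →L[ℝ] EuclideanSpace ℝ (Fin n) :=
    (ContinuousLinearMap.fst ℝ _ ℝ).comp F' with hP'
  have hPderiv : HasFDerivAt P P' a₀ := hFderiv.fst
  have hP'inj : Injective P' := by
    intro v w hvw
    apply hF'inj
    refine Prod.ext hvw ?_
    have h1 : (F' v).2 = 0 := by
      simpa using congrArg (fun A : EuclideanSpace ℝ (Fin n) →L[ℝ] ℝ ↦ A v) hg'zero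
    have h2 : (F' w).2 = 0 := by
      simpa using congrArg (fun A : EuclideanSpace ℝ (Fin n) →L[ℝ] ℝ ↦ A w) hg'zero
    rw [h1, h2]
  set Pe : EuclideanSpace ℝ (Fin n) ≃L[ℝ] EuclideanSpace ℝ (Fin n) :=
    (LinearEquiv.ofInjectiveEndo P'.toLinearMap hP'inj).toContinuousLinearEquiv with hPe
  have hPecoe : (Pe : EuclideanSpace ℝ (Fin n) →L[ℝ] EuclideanSpace ℝ (Fin n)) = P' := by
    ext v
    simp [hPe]
  have hPderiv' : HasFDerivAt P (Pe : EuclideanSpace ℝ (Fin n) →L[ℝ] EuclideanSpace ℝ (Fin n)) a₀ := by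
    rw [hPecoe]; exact hPderiv
  -- inverse function theorem for `P` at `a₀`
  have hPc : ContDiffAt ℝ ∞ P a₀ := hPsmooth a₀ ha₀A₁
  have hn0 : (∞ : ℕ∞ω) ≠ 0 := by simp
  set Φ := hPc.toOpenPartialHomeomorph P hPderiv' hn0 with hΦ
  have hΦcoe : (Φ : EuclideanSpace ℝ (Fin n) → EuclideanSpace ℝ (Fin n)) = P :=
    hPc.toOpenPartialHomeomorph_coe hPderiv' hn0
  have ha₀Φ : a₀ ∈ Φ.source := hPc.mem_toOpenPartialHomeomorph_source hPderiv' hn0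
  -- shrink to where `P` is smooth with invertible differential
  set A₂ : Set (EuclideanSpace ℝ (Fin n)) := A₁ ∩ Φ.source with hA₂
  have hA₂open : IsOpen A₂ := hA₁open.inter Φ.open_source
  have hPA₂ : ContDiffOn ℝ ∞ P A₂ := fun a ha ↦ (hPsmooth a ha.1).contDiffWithinAt
  have hPcont : ContinuousOn (fderiv ℝ P) A₂ := hPA₂.continuousOn_fderiv_of_isOpen hA₂open (by simp)
  set A₃ : Set (EuclideanSpace ℝ (Fin n)) := A₂ ∩ fderiv ℝ P ⁻¹'
    range ((↑) : (EuclideanSpace ℝ (Fin n) ≃L[ℝ] EuclideanSpace ℝ (Fin n)) →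
      EuclideanSpace ℝ (Fin n) →L[ℝ] EuclideanSpace ℝ (Fin n)) with hA₃
  have hA₃open : IsOpen A₃ := hPcont.isOpen_inter_preimage hA₂open ContinuousLinearEquiv.isOpen
  have ha₀A₃ : a₀ ∈ A₃ := ⟨⟨ha₀A₁, ha₀Φ⟩, ⟨Pe, hPderiv'.fderiv.symm⟩⟩
  -- shrink further so that `P` maps into the prescribed neighbourhood `G` of `x₀`
  have hx₀ : (T (ψ (f y₀))).1 = P a₀ := by
    simp only [hP]
    rw [hFchart y₀ hy₀φ (hWψ y₀ hy₀)]
  have hPcontA₃ : ContinuousOn P A₃ := fun a ha ↦ (hPsmooth a ha.1.1).continuousAt.continuousWithinAt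
  set A : Set (EuclideanSpace ℝ (Fin n)) := A₃ ∩ P ⁻¹' interior G with hA
  have hAopen : IsOpen A := hPcontA₃.isOpen_inter_preimage hA₃open isOpen_interior
  have ha₀A : a₀ ∈ A := ⟨ha₀A₃, by rw [mem_preimage, ← hx₀]; exact mem_interior_iff_mem_nhds.mpr hG⟩
  have hAΦ : A ⊆ Φ.source := fun a ha ↦ ha.1.1.2
  have hAA₁ : A ⊆ A₁ := fun a ha ↦ ha.1.1.1
  have hAG : P '' A ⊆ G := by
    rintro _ ⟨a, ha, rfl⟩
    exact interior_subset ha.2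
  -- the data
  set V : Set (EuclideanSpace ℝ (Fin n)) := Φ '' A with hV
  set W₀ : Set S := φ.source ∩ φ ⁻¹' A with hW₀
  set u : EuclideanSpace ℝ (Fin n) → ℝ := g ∘ Φ.symm with hu
  have hVopen : IsOpen V := Φ.isOpen_image_of_subset_source hAopen hAΦ
  have hW₀open : IsOpen W₀ := φ.isOpen_inter_preimage hAopen
  have hW₀W : W₀ ⊆ W := by
    rintro y ⟨hy, hyA⟩
    have := (hAA₁ hyA).2
    rwa [mem_preimage, φ.left_inv hy] at this
  have hW₀F : ∀ y ∈ W₀, T (ψ (f y)) = F (φ y) := fun y hy ↦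
    (hFchart y hy.1 (hWψ y (hW₀W hy))).symm
  refine ⟨W₀, V, u, hW₀open, ⟨hy₀φ, ha₀A⟩, hW₀W, hVopen, ?_, ?_, ?_, ?_, ?_, ?_, ?_, ?_⟩
  · -- `x₀ ∈ V`
    rw [hx₀, ← hΦcoe]
    exact mem_image_of_mem Φ ha₀A
  · -- `V ⊆ G`
    rw [hV, hΦcoe]
    exact hAG
  · -- the horizontal coordinate maps `W₀` onto `V`
    apply Subset.antisymm
    · rintro _ ⟨y, hy, rfl⟩
      refine ⟨φ y, hy.2, ?_⟩
      simp only [hΦcoe, hP, hW₀F y hy]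
    · rintro _ ⟨a, ha, rfl⟩
      have haφ : a ∈ φ.target := (hAA₁ ha).1
      have hya : φ.symm a ∈ W₀ :=
        ⟨φ.map_target haφ, by rw [mem_preimage, φ.right_inv haφ]; exact ha⟩
      refine ⟨φ.symm a, hya, ?_⟩
      show (T (ψ (f (φ.symm a)))).1 = Φ a
      rw [hW₀F _ hya, φ.right_inv haφ, hΦcoe]
  · -- graph property
    intro y hy
    rw [hW₀F y hy]
    simp only [hu, comp_apply]
    show g (φ y) = g (Φ.symm (P (φ y)))
    rw [← hΦcoe, Φ.left_inv (hAΦ hy.2)]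
  · -- smoothness of `u` on `V`
    rintro _ ⟨a, ha, rfl⟩
    obtain ⟨Ea, hEa⟩ := ha.1.2
    have hPa : HasFDerivAt Φ (Ea : EuclideanSpace ℝ (Fin n) →L[ℝ] EuclideanSpace ℝ (Fin n))
        (Φ.symm (Φ a)) := by
      rw [Φ.left_inv (hAΦ ha), hΦcoe, hEa]
      exact ((hPsmooth a (hAA₁ ha)).differentiableAt (by simp)).hasFDerivAt
    have hsymm : ContDiffAt ℝ ∞ Φ.symm (Φ a) :=
      Φ.contDiffAt_symm (Φ.map_source (hAΦ ha)) hPa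
        (by rw [Φ.left_inv (hAΦ ha), hΦcoe]; exact hPsmooth a (hAA₁ ha))
    have hga : ContDiffAt ℝ ∞ g (Φ.symm (Φ a)) := by
      rw [Φ.left_inv (hAΦ ha)]; exact hgsmooth a (hAA₁ ha)
    exact (hga.comp (Φ a) hsymm).contDiffWithinAt
  · -- `u ≤ 0` on `V`
    rintro _ ⟨a, ha, rfl⟩
    simp only [hu, comp_apply, Φ.left_inv (hAΦ ha)]
    exact hA₁g a (hAA₁ ha)
  · -- `u x₀ = 0`
    rw [hx₀]
    simp only [hu, comp_apply]
    rw [← hΦcoe, Φ.left_inv ha₀Φ]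
    exact hga₀
  · -- `du x₀ = 0`
    rw [hx₀]
    have hsymm : HasFDerivAt Φ.symm (Pe.symm : EuclideanSpace ℝ (Fin n) →L[ℝ] EuclideanSpace ℝ (Fin n))
        (P a₀) := by
      refine Φ.hasFDerivAt_symm ?_ ?_
      · rw [← hΦcoe]; exact Φ.map_source ha₀Φ
      · rw [← hΦcoe, Φ.left_inv ha₀Φ, hΦcoe]; exact hPderiv'
    have hg0 : HasFDerivAt g (0 : EuclideanSpace ℝ (Fin n) →L[ℝ] ℝ) (Φ.symm (P a₀)) := by
      rw [← hΦcoe, Φ.left_inv ha₀Φ]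
      rw [hg'zero] at hgderiv
      exact hgderiv
    have := hg0.comp (P a₀) hsymm
    simp only [ContinuousLinearMap.zero_comp] at this
    exact this.fderiv

end Literature.Geometry.Lorentzian

end
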